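import Summits.BirchSwinnertonDyer.BirchSwinnertonDyer.Theorems.AdditiveKolyvaginRoadLevelSystemsRigidityCongruences
import Summits.BirchSwinnertonDyer.BirchSwinnertonDyer.Theorems.AdditiveKolyvaginRoadLevelSystemsCoreConnectedOfPoitouTate
import Summits.BirchSwinnertonDyer.BirchSwinnertonDyer.Theorems.AdditiveKolyvaginRoadLevelSystemsSelmerBottom
import HarnessLib

/-!
# Route `AdditiveKolyvaginRoad`, crux `LevelKolyvaginSystemsAdditive` (item stmt-BirchSwinnertonDyer-21396, KS′):
# KS′'s conclusion at a ♯ frame from Zhang-shape classes, the CONGRUENCES (SRL) + (V) and ONE class seed, granted PUB ∕ DUAL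
# ONLY — the congruence-form producer of width seat w2 g2's rigidity chain with its two E-side binders ((R′), `selmer_bottom`)
# DISCHARGED
# (cell `pub/bsd-wall`, width seat `bsd-wall-akr-p2x-w3` g3; `--supports stmt-BirchSwinnertonDyer-21396`, helper; companion of
# `…LevelSystemsOfSeedCruxFree` (bipartite-law form, BY NAME) for the producers that give W. Zhang's Thm 4.3 congruence (SRL)
# and the co-level congruence (V) instead of the two-sided Bertolini–Darmon laws; inside the route file's import cone via
# `…RigidityCongruences` ∕ `PublishedInputsAdditiveKoly`)

WHAT. `nonempty_levelKolyvaginSystemP_of_reciprocity_of_seed_of_published_free` = w2 g2's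
`nonempty_levelKolyvaginSystemP_of_reciprocity_of_seed_of_published` (p592335) with
* (R′) `hraise` DISCHARGED by `selQP_raise_free … (hDual.2 K)` (this seat, p593014 on p592271 / p591641), and
* `selmer_bottom` DISCHARGED by `selmer_bottom_of_realisation` (this seat, p594057: `c(1) = δ(y_K)` is a signed Selmer class).
KERNEL READING: a congruence-form KS′ line at `p² ∣ N` must supply exactly — signs, EVEN-level classes `κ₀` realised by
Kolyvagin–Heegner data at level `∅` with the carrier's axioms at non-empty even levels, (SRL) two-sided at every conductor, the
co-level congruence (V) at conductor `∅`, and ONE non-zero conductor-one class `κ₀(∅, n₀)` at an even level of total canonical rank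
`≤ 1` — and nothing E-side beyond the route's displayed named facts PUB ∧ DUAL.

HONEST FRAMING: one theorem; 0 definitions, 0 named facts, 0 `sorry`; CONDITIONAL (PUB ∕ DUAL by name, the classes, the congruences
and the seed are HYPOTHESES); closes nothing. BSD is not proved by any of this.

References: [cite: WZhang2014, Thm. 4.3, (4.8), Lemma 5.3, Prop. 5.4, Thm. 7.2, Lemma 7.3, §8.1, §9] [cite: BertoliniDarmon2005,
Lemma 2.6, Thm. 3.2, Thm. 4.1] [cite: Howard2006Bipartite, Prop. 2.4.11, Thm. 2.5.1] [cite: GrossLMS1991, §4 (4.4), Prop. 5.3].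
-/

-- single-conjunct summit: `Summit.BirchSwinnertonDyer.BirchSwinnertonDyer.…` repeats the name by design
set_option linter.dupNamespace false

noncomputable section

open scoped Classical

namespace Summit.BirchSwinnertonDyer.BirchSwinnertonDyer.Theorems.AdditiveKoly

open WeierstrassCurve NumberField IsDedekindDomain
  Literature.NumberTheory.EllipticCurves Literature.NumberTheory.EllipticCurves.ModularForms
  Literature.NumberTheory.EllipticCurves.Rank1Residual Literature.NumberTheory.GaloisRepresentations Module
  Summit.BirchSwinnertonDyer.Rank1Residual.X11b.Three.Koly
  Summit.BirchSwinnertonDyer.BirchSwinnertonDyer.Theses.AdditiveKolyvaginRoad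

variable (W : WeierstrassCurve ℚ) (K : Type) [Field K] [NumberField K] (p : ℕ) [W.IsElliptic] [W.IsGloballyMinimal]
  [NeZero (W.conductorNorm ℤ)] [Fact p.Prime] (c : K ≃ₐ[ℚ] K) [Module (ZMod p) (Vp W K p)]
  (Dt : ModularParametrizationData W (W.conductorNorm ℤ)) (β : ℤ) (ι : K →+* ℂ)

/-- **KS′'s conclusion at a ♯ additive frame from Zhang-shape classes, the congruences (SRL) + (V) and ONE CLASS SEED, granted the
route's published inputs ONLY** — w2 g2's `nonempty_levelKolyvaginSystemP_of_reciprocity_of_seed_of_published` with (R′) discharged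
by `selQP_raise_free` (Poitou–Tate conjunct of DUAL) and `selmer_bottom` discharged by `selmer_bottom_of_realisation`. Binders:
the frame, `ε₀`, `κ₀` with realisation and the carrier's axioms at non-empty even levels, `reciprocity` = (SRL) two-sided,
`colevel` = (V), an even level `n₀` of total rank `≤ 1` with `κ₀(∅, n₀) ≠ 0`. CONDITIONAL; closes nothing; BSD is not proved by
this. [cite: WZhang2014, Thm. 4.3, Lemma 5.3, Thm. 7.2, §9] [cite: BertoliniDarmon2005, Thm. 4.1] [cite: Howard2006Bipartite, Thm. 2.5.1] -/
theorem nonempty_levelKolyvaginSystemP_of_reciprocity_of_seed_of_published_free (hPUB : PublishedInputsAdditiveKoly)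
    (hDual : PublishedDualityInputsAdditiveKoly) (h5 : 5 ≤ p) (hadd : Addv W p) (hsurj : W.HasSurjectiveModNGaloisRep p)
    (hsp : ∀ (ℓ : ℕ) [Fact ℓ.Prime], W.HasMultiplicativeReductionAtPrime ℓ →
      ¬ p ∣ padicValInt ℓ W.minimalDiscriminantInt)
    (htwo : ∃ (ℓ₁ ℓ₂ : ℕ) (_ : Fact ℓ₁.Prime) (_ : Fact ℓ₂.Prime), ℓ₁ ≠ ℓ₂ ∧
      W.HasMultiplicativeReductionAtPrime ℓ₁ ∧ W.HasMultiplicativeReductionAtPrime ℓ₂)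
    (htam : ¬ p ∣ W.tamagawaProduct) (hr : W.analyticRank = 1)
    (hK : IsImaginaryQuadratic K) (hodd : Odd (NumberField.discr K))
    (hH : SatisfiesHeegnerHypothesis (W.conductorNorm ℤ) K)
    (hL : (W.quadraticTwist (NumberField.discr K : ℚ)).entireLFunction 1 ≠ 0)
    (hβ : (4 * (W.conductorNorm ℤ : ℤ)) ∣ β ^ 2 - NumberField.discr K) (hcM : ¬ (p : ℤ) ∣ Dt.c) (hc1 : c ≠ 1)
    (ε₀ : Finset (AdmQ W K p) → Bool)
    (κ₀ : Finset {ℓ // Zhang2014.IsKolyvaginPrime (W.conductorNorm ℤ) W K p ℓ} → Finset (AdmQ W K p) → Vp W K p)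
    (realisation : ∀ m : Finset {ℓ // Zhang2014.IsKolyvaginPrime (W.conductorNorm ℤ) W K p ℓ},
      ∃ d : KolyvaginHeegnerData Dt β ι (∏ ℓ ∈ m, (ℓ : ℕ)), κ₀ m ∅ = d.kolyvaginClass (Fact.out : p.Prime) 1)
    (sign : ∀ n : Finset (AdmQ W K p), n.Nonempty → Even n.card →
      ∀ m : Finset {ℓ // Zhang2014.IsKolyvaginPrime (W.conductorNorm ℤ) W K p ℓ},
      conjAct W c ((p ^ 1 : ℕ) : ℤ) (κ₀ m n) = sgnP (ε₀ n ^^ Nat.bodd m.card) • κ₀ m n)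
    (selmer_off : ∀ n : Finset (AdmQ W K p), n.Nonempty → Even n.card →
      ∀ (m : Finset {ℓ // Zhang2014.IsKolyvaginPrime (W.conductorNorm ℤ) W K p ℓ}) (v : HeightOneSpectrum (𝓞 K)),
      (∀ ℓ ∈ m, ((ℓ : ℕ) : 𝓞 K) ∉ v.asIdeal) → (∀ q ∈ n, ((q : ℕ) : 𝓞 K) ∉ v.asIdeal) →
      κ₀ m n ∈ selmerLocalKer (W.baseChange K) (v.adicCompletion K) ((p ^ 1 : ℕ) : ℤ))
    (selmer_inf : ∀ n : Finset (AdmQ W K p), n.Nonempty → Even n.card →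
      ∀ (m : Finset {ℓ // Zhang2014.IsKolyvaginPrime (W.conductorNorm ℤ) W K p ℓ}) (w : InfinitePlace K),
      κ₀ m n ∈ selmerLocalKer (W.baseChange K) w.Completion ((p ^ 1 : ℕ) : ℤ))
    (toric_on : ∀ n : Finset (AdmQ W K p), n.Nonempty → Even n.card →
      ∀ m : Finset {ℓ // Zhang2014.IsKolyvaginPrime (W.conductorNorm ℤ) W K p ℓ}, ∀ q ∈ n,
      ∀ v : HeightOneSpectrum (𝓞 K),
      ((q : ℕ) : 𝓞 K) ∈ v.asIdeal → κ₀ m n ∈ toricLocalKer (W.baseChange K) (v.adicCompletion K) ((p ^ 1 : ℕ) : ℤ))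
    (transverse_on : ∀ n : Finset (AdmQ W K p), n.Nonempty → Even n.card →
      ∀ m : Finset {ℓ // Zhang2014.IsKolyvaginPrime (W.conductorNorm ℤ) W K p ℓ}, ∀ ℓ ∈ m,
      ∀ v : HeightOneSpectrum (𝓞 K),
      ((ℓ : ℕ) : 𝓞 K) ∈ v.asIdeal → κ₀ m n ∈ transverseLocalKerP W K p ι ℓ v)
    (relation : ∀ n : Finset (AdmQ W K p), n.Nonempty → Even n.card →
      ∀ (m : Finset {ℓ // Zhang2014.IsKolyvaginPrime (W.conductorNorm ℤ) W K p ℓ})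
        (ℓ : {ℓ // Zhang2014.IsKolyvaginPrime (W.conductorNorm ℤ) W K p ℓ}), ℓ ∉ m → ∀ v : HeightOneSpectrum (𝓞 K),
      ((ℓ : ℕ) : 𝓞 K) ∈ v.asIdeal →
      (κ₀ (insert ℓ m) n ∈ (W.baseChange K).torsionLocalKer (v.adicCompletion K) ((p ^ 1 : ℕ) : ℤ) ↔
        κ₀ m n ∈ (W.baseChange K).torsionLocalKer (v.adicCompletion K) ((p ^ 1 : ℕ) : ℤ)))
    (reciprocity : ∀ (n : Finset (AdmQ W K p)) (q₁ q₂ : AdmQ W K p), q₁ ∉ n → q₂ ∉ insert q₁ n → Even n.card →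
      ∀ (m : Finset {ℓ // Zhang2014.IsKolyvaginPrime (W.conductorNorm ℤ) W K p ℓ}) (v₁ v₂ : HeightOneSpectrum (𝓞 K)),
      ((q₁ : ℕ) : 𝓞 K) ∈ v₁.asIdeal → ((q₂ : ℕ) : 𝓞 K) ∈ v₂.asIdeal →
      (κ₀ m n ∈ (W.baseChange K).torsionLocalKer (v₁.adicCompletion K) ((p ^ 1 : ℕ) : ℤ) ↔
        κ₀ m (insert q₂ (insert q₁ n)) ∈ (W.baseChange K).torsionLocalKer (v₂.adicCompletion K) ((p ^ 1 : ℕ) : ℤ)))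
    (colevel : ∀ (n' : Finset (AdmQ W K p)) (a b : AdmQ W K p), Odd n'.card → a ∉ n' → b ∉ n' →
      ∀ (va vb : HeightOneSpectrum (𝓞 K)), ((a : ℕ) : 𝓞 K) ∈ va.asIdeal → ((b : ℕ) : 𝓞 K) ∈ vb.asIdeal →
      (κ₀ ∅ (insert a n') ∈ (W.baseChange K).torsionLocalKer (va.adicCompletion K) ((p ^ 1 : ℕ) : ℤ) ↔
        κ₀ ∅ (insert b n') ∈ (W.baseChange K).torsionLocalKer (vb.adicCompletion K) ((p ^ 1 : ℕ) : ℤ)))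
    (n₀ : Finset (AdmQ W K p)) (hn₀ : Even n₀.card)
    (hcore₀ : finrank (ZMod p) (SelQP W K p c n₀ true) + finrank (ZMod p) (SelQP W K p c n₀ false) ≤ 1)
    (seed : κ₀ ∅ n₀ ≠ 0) :
    Nonempty (LevelKolyvaginSystemP W K p Dt β ι c) :=
  nonempty_levelKolyvaginSystemP_of_reciprocity_of_seed_of_published W K p c Dt β ι hPUB hDual h5 hadd hsurj hsp htwo htam hr
    hK hodd hH hL hβ hcM hc1 ε₀ κ₀ realisation sign selmer_off selmer_inf toric_on transverse_on relation reciprocity colevel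
    (selmer_bottom_of_realisation W p K Dt β ι hsurj hK hH hc1 κ₀ realisation) n₀ hn₀ hcore₀ seed
    (selQP_raise_free W K p hK (by omega) c (hDual.2 K))

end Summit.BirchSwinnertonDyer.BirchSwinnertonDyer.Theorems.AdditiveKoly

end
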